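import Summits.BirchSwinnertonDyer.BirchSwinnertonDyer.Theorems.GenusKolyvaginAtTwoGenusPrimitiveSupplyAtTwoUnconditional
import Summits.BirchSwinnertonDyer.BirchSwinnertonDyer.Theorems.GenusKolyvaginAtTwoGenusPrimitiveSupplyAtTwoTwinConverse
import Summits.BirchSwinnertonDyer.BirchSwinnertonDyer.Theorems.GenusKolyvaginAtTwoPowDvdShaCardAtTwoRTGenusBudgetPrimeDisc
import HarnessLib

/-!
# Route `GenusKolyvaginAtTwo`, crux #2 `GenusPrimitiveSupplyAtTwo` (stmt-BirchSwinnertonDyer-22136):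
# STUB A WITH THE HABITAT CUT (E1) BUILT IN — the `2`-Selmer-minimal analytic-rank-one twin at a prime Heegner field of genus budget
# `ord₂ C(Wd) = 1`, modulo {Modularity, 2-parity (elliptic form), (CONV₂)} only

Width seat `bsd-line-gk2-p5` g20 (cell `bsd-f1-sign2`, SUPPLY lineage), companion of `…HabitatCutSupply` / `…HabitatCutReach`. THEOREMS ONLY
(no definition, no named fact, no `sorry`); helper `--supports stmt-BirchSwinnertonDyer-22136`; no item is closed; BSD is not proved by any of this.

WHY. The registered stub A of line `genus-supply` («for `W` on the habitat, a Kolyvagin-(H2)-admissible Heegner field `K` with a globally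
minimal `2`-Selmer-minimal twin `Wd ≅ W^{(d_K)}` of analytic rank `1`») is a tree theorem modulo {Modularity, `2`-parity, (CONV₂)}
(`GenusKoly.stub_minimalTwinSupplyAtTwo_of_twoConverse` ∘ the LEAD's unconditional SUPPLY″). LINE 18 (L_T, stmt-23242) asks the pen to
restate crux 22136 with the habitat cut (E1) «`ord₂ C(Wd) = 1`» (and `2` split, and (β″)-precise witness primes). This file pre-builds the
supply-side SOCKET of that restatement: stub A's conclusion PLUS `2` split PLUS **`padicValNat 2 Wd.tamagawaProduct = 1`**, on the habitat
cut out by `Δ_W < 0`, `C(W)` odd and `#Sel₂(W) ∈ {1, 4}` (the necessary clause V14a: `…HabitatCutReach`), modulo the SAME displayed inputs as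
stub A — Modularity `exists_isNewformOf`, the `2`-parity theorem in its ELLIPTIC form `∀ V [V.IsElliptic], p_parity V 2` (route item
`TwoParityDD` is typed without `[IsElliptic]`; only elliptic twins are used here), and the rank-one `2`-converse (CONV₂) — nothing new:

* `stub_minimalTwinSupplyAtTwo_genusBudget_one_of_twoConverse` — ∀ `W` (globally minimal, non-CM, `r_an = 0`, `2`-adic tower onto,
  `Δ_W < 0`, `C(W)` odd, `#Sel₂(W) ∈ {1,4}`): ∃ prime `ℓ ≡ 7 (8)`, `ℓ ∤ N_W`, `K = ℚ(√−ℓ)` with every K-clause of 22136 and `2` split,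
  ∃ globally minimal `Wd ≅ W^{(d_K)}`: `¬ Wd.HasCM ∧ Wd.analyticRank = 1 ∧ #Sel₂(Wd) = 2 ∧ padicValNat 2 Wd.tamagawaProduct = 1`.
  Proof: LEAD g10's `GenusKolyPR.supply_DEF1_minimalTwin_habitat` (unconditional) + gk2-p2 g17's
  `padicValNat_two_tamagawaProduct_twin_eq_one_of_prime` + the rank-one bookkeeping of `…TwinConverse` (`rootNumber_twin_eq_neg_one` from
  Modularity, `odd_selmerCorank_two_of_p_parity`, `selmerCorank_two_eq_one_of_card_selmerGroup_two`, then (CONV₂)).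

Honest framing: conditional exactly like stub A (Modularity, `2`-parity, (CONV₂) displayed); U (24947) untouched; crux 22136 OPEN at (U) ∧ (CONV₂).

References: [MazurRubin2010] Thm. 2.7, Prop. 3.3, Cor. 3.4 (i); [Kramer1981] §2 Prop. 3; [DokchitserDokchitserAnnals2010] Thm. 1.4;
[Darmon2004] §3.6 Thm. 3.17; [GrossLMS1991] §1.
-/

set_option linter.dupNamespace false -- tree convention: `Summit.BirchSwinnertonDyer.BirchSwinnertonDyer.Theorems` (summit = sub-problem)
set_option autoImplicit false

noncomputable section

open scoped Classical

namespace Summit.BirchSwinnertonDyer.BirchSwinnertonDyer.Theorems.GenusKolyTwistingPrime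

open WeierstrassCurve NumberField Literature.NumberTheory.EllipticCurves
open Literature.NumberTheory.EllipticCurves.ModularForms
open Summit.BirchSwinnertonDyer.BirchSwinnertonDyer.Theorems.GenusKoly
  (natCard_twoTorsion_twin_eq_one rootNumber_twin_eq_neg_one odd_selmerCorank_two_of_p_parity
    selmerCorank_two_eq_one_of_card_selmerGroup_two twin_not_hasCM)

/-- **STUB A WITH (E1): the `2`-Selmer-minimal analytic-rank-one twin at a PRIME Heegner field has genus budget exactly one bit**, modulo
Modularity, the `2`-parity theorem (elliptic form) and the rank-one `2`-converse (CONV₂).  For `W/ℚ` globally minimal elliptic, non-CM,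
`r_an(W) = 0`, `ρ_{W,2^n}` onto for all `n ≥ 1`, `Δ_W < 0`, `C(W)` odd and `#Sel₂(W) ∈ {1, 4}`: there are a prime `ℓ ≡ 7 (mod 8)`, `ℓ ∤ N_W`,
the Heegner field `K = ℚ(√−ℓ)` (imaginary quadratic, `d_K = −ℓ` odd `≠ −3`, Heegner for `N_W`, `d_K·(−|Δ|)` and `d_K·(−2|Δ|)` non-squares,
`2` split) and a globally minimal twin `Wd ≅ W^{(d_K)}` which is non-CM, has analytic rank `1`, `#Sel₂(Wd) = 2`, and `ord₂ C(Wd) = 1`.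
The analytic rank: `w(Wd) = −w(W) = −1` (Modularity; every `q ∣ N_W` splits), `2`-parity ⟹ odd `2^∞`-Selmer corank, `#Sel₂ = 2` and
`Wd(ℚ)[2] = 0` ⟹ corank `1`, (CONV₂) ⟹ `r_an(Wd) = 1`. BSD is not proved by this. [cite: MazurRubin2010, Thm. 2.7, Prop. 3.3, Cor. 3.4 (i)]
[cite: Kramer1981, §2 Prop. 3] [cite: DokchitserDokchitserAnnals2010, Thm. 1.4] [cite: Darmon2004, §3.6 Thm. 3.17] [cite: GrossLMS1991, §1 (p. 235)] -/
theorem stub_minimalTwinSupplyAtTwo_genusBudget_one_of_twoConverse (hmod : exists_isNewformOf)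
    (hpar : ∀ (V : WeierstrassCurve ℚ) [V.IsElliptic], p_parity V 2)
    (hconv : ∀ (V : WeierstrassCurve ℚ) [V.IsElliptic] [V.IsGloballyMinimal],
      ¬ V.HasCM → V.selmerCorank 2 = 1 → V.analyticRank = 1)
    (W : WeierstrassCurve ℚ) [W.IsElliptic] [W.IsGloballyMinimal] (hcm : ¬ W.HasCM) (hr0 : W.analyticRank = 0)
    (hρ : ∀ n : ℕ, 0 < n → W.HasSurjectiveModNGaloisRep ((2 : ℤ) ^ n)) (hΔ : W.Δ < 0) (hT : Odd W.tamagawaProduct)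
    (h14 : Nat.card (W.selmerGroup 2) = 1 ∨ Nat.card (W.selmerGroup 2) = 4) :
    ∃ ℓ : ℕ, ℓ.Prime ∧ ℓ % 8 = 7 ∧ ¬ ℓ ∣ W.conductorNorm ℤ ∧
      ∃ (K : Type) (_ : Field K) (_ : NumberField K), IsImaginaryQuadratic K ∧ discr K = -(ℓ : ℤ) ∧ Odd (discr K) ∧
        discr K ≠ -3 ∧ SatisfiesHeegnerHypothesis (W.conductorNorm ℤ) K ∧
        ¬ IsSquare ((discr K : ℚ) * -|W.Δ|) ∧ ¬ IsSquare ((discr K : ℚ) * (-(2 * |W.Δ|))) ∧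
        ((Ideal.span {(2 : ℤ)}).primesOver (𝓞 K)).ncard = 2 ∧
        ∃ (Wd : WeierstrassCurve ℚ) (_ : Wd.IsElliptic) (_ : Wd.IsGloballyMinimal),
          (∃ C : VariableChange ℚ, C • W.quadraticTwist (discr K : ℚ) = Wd) ∧ ¬ Wd.HasCM ∧ Wd.analyticRank = 1 ∧
          Nat.card (Wd.selmerGroup 2) = 2 ∧ padicValNat 2 Wd.tamagawaProduct = 1 := by
  have hε : 0 < W.Δ → Nat.card (W.selmerGroup 2) = 4 → ¬ Summit.BirchSwinnertonDyer.Rank1Residual.F1Sign2.DescentSignNeg W :=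
    fun h _ ↦ absurd h (not_lt.mpr hΔ.le)
  obtain ⟨ℓ, -, hℓ, hℓ8, hℓN, -, K, _, _, hK, hd, hodd, hd3, hH, hsq1, hsq2, h2K, Wd, _, _, hWd, hSelWd⟩ :=
    GenusKolyPR.supply_DEF1_minimalTwin_habitat W hρ h14 hε 0
  have hprime : (discr K).natAbs.Prime := by
    rw [hd, Int.natAbs_neg, Int.natAbs_natCast]
    exact hℓ
  obtain ⟨Cd, hCd⟩ := hWd
  have hB : padicValNat 2 Wd.tamagawaProduct = 1 :=
    GenusExact.PlusDescent.padicValNat_two_tamagawaProduct_twin_eq_one_of_prime W hK hodd hH hT hΔ hprime Cd hCd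
  -- analytic rank one of the twin (the bookkeeping of `…TwinConverse`)
  have hdQ : (discr K : ℚ) ≠ 0 := by exact_mod_cast NumberField.discr_ne_zero K
  have hcmd : ¬ Wd.HasCM := twin_not_hasCM W hcm hdQ Wd ⟨Cd, hCd⟩
  have htors := natCard_twoTorsion_twin_eq_one W (hρ 1 one_pos) hdQ Wd ⟨Cd, hCd⟩
  have hw := rootNumber_twin_eq_neg_one hmod W hr0 K hK hH Wd ⟨Cd, hCd⟩
  have hco := selmerCorank_two_eq_one_of_card_selmerGroup_two Wd htors hSelWd (odd_selmerCorank_two_of_p_parity Wd (hpar Wd) hw)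
  exact ⟨ℓ, hℓ, hℓ8, hℓN, K, inferInstance, inferInstance, hK, hd, hodd, hd3, hH, hsq1, hsq2, h2K, Wd, inferInstance, inferInstance,
    ⟨Cd, hCd⟩, hcmd, hconv Wd hcmd hco, hSelWd, hB⟩

end Summit.BirchSwinnertonDyer.BirchSwinnertonDyer.Theorems.GenusKolyTwistingPrime

end
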